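import Mathlib
import HarnessLib
import Literature.Computability.AlgebraicComplexity.PatternExpressions
import Summits.ValiantsHypothesis.ValiantsHypothesis.Theorems.MonotoneRestorationMonotoneRestorationQPZetaPatterns
import Summits.ValiantsHypothesis.ValiantsHypothesis.Theorems.MonotoneRestorationOrbitCompressionQPMultiRowGadget
import Summits.ValiantsHypothesis.ValiantsHypothesis.Theorems.MonotoneRestorationOrbitCompressionQPPinnedProducts

/-!
# Route MonotoneRestoration — aside `OrbitCompressionQP` (stmt-ValiantsHypothesis-18332), line
# `expression_compression`: the new strata IN THE CRUX'S OWN CURRENCY (square-symmetric circuits of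
# quasi-polynomial SIZE)

`…StrataCircuits.lean` (hand -3 g2) records the one-row strata of the crux `OrbitCompressionQP` in its exact
conclusion shape via THEOREM ζ-P (`Theorems.qpSymmetric_patternExpr`).  This file does the same for the strata
landed by hand -3 g3: the `k`-row column-gadget stratum, the second-row-affine and second-row-quadratic 2-row
strata, and the pinned-product strata.  Each is one line: ζ-P after the NQP theorem.  (The crux's
hypotheses — `VP`, qp ORBIT size — are not needed for these families: the conclusion holds outright.)

Helper file (`--supports stmt-ValiantsHypothesis-18332`); def-free; nothing here is a named fact; no registered
stub is closed; VP ≠ VNP is not moved.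
-/

noncomputable section

open MvPolynomial

-- `Summit.ValiantsHypothesis.ValiantsHypothesis.…` is the tree's single-conjunct layout (Sub = Summit).
set_option linter.dupNamespace false

namespace Summit.ValiantsHypothesis.ValiantsHypothesis.Theorems

namespace FormulaSubstitution

open Literature.Computability.AlgebraicComplexity

/-- **`k`-row column-gadget families have square-symmetric circuits of quasi-polynomial SIZE** (the
conclusion of `OrbitCompressionQP`, unconditionally). [cite: BlaserJindal2019, Thm. 4] -/
theorem qpSymmetricSize_multiRow_columnGadget (k : ℕ) (h : (n : ℕ) → MvPolynomial (Fin n) ℂ)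
    (hsymm : ∀ n, (h n).IsSymmetric) (hh : IsVQPFamily h)
    (U : ℕ → PatternExpr ℂ k 1)
    (u : (n : ℕ) → (Fin k → Fin n) → Fin n → MvPolynomial (Fin n × Fin n) ℂ)
    (hU : ∃ c : ℕ, ∀ n : ℕ, 1 ≤ n → (U n).length ≤ 2 ^ ((Nat.log 2 n + c) ^ c) ∧
      ∀ (ρ : Fin k → Fin n) (γ : Fin 1 → Fin n), (U n).value n ρ γ = u n ρ (γ 0)) :
    ∃ c : ℕ, ∀ n : ℕ, ∃ (G : Type) (_ : Fintype G)
      (C : LabelledArithCircuit ℂ (Fin n × Fin n) Unit G),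
      C.IsSymmetric (Equiv.Perm (Fin n)) ∧
        C.eval (C.output ()) = ∑ ρ : Fin k → Fin n, aeval (u n ρ) (h n) ∧
        Fintype.card G ≤ 2 ^ ((Nat.log 2 n + c) ^ c) :=
  qpSymmetric_patternExpr _ (narrowQP_multiRow_columnGadget k h hsymm hh U u hU)

/-- **Second-row-affine 2-row families have square-symmetric circuits of quasi-polynomial SIZE.**
[cite: BlaserJindal2019, Thm. 4] -/
theorem qpSymmetricSize_twoRow_pinnedAffine (H : (n : ℕ) → MvPolynomial (Option (Fin n)) ℂ)
    (hsymm : ∀ (n : ℕ) (τ : Equiv.Perm (Fin n)), rename (Option.map τ) (H n) = H n)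
    (hH : IsVQPFamily H) :
    ∃ c : ℕ, ∀ n : ℕ, ∃ (G : Type) (_ : Fintype G)
      (C : LabelledArithCircuit ℂ (Fin n × Fin n) Unit G),
      C.IsSymmetric (Equiv.Perm (Fin n)) ∧
        C.eval (C.output ()) = ∑ i : Fin n, ∑ b : Fin n,
          (∑ i' : Fin n, (X (i', b) : MvPolynomial (Fin n × Fin n) ℂ)) *
          aeval (fun o : Option (Fin n) => o.elim (X (i, b))
            (fun j => (X (i, j) : MvPolynomial (Fin n × Fin n) ℂ))) (H n) ∧
        Fintype.card G ≤ 2 ^ ((Nat.log 2 n + c) ^ c) :=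
  qpSymmetric_patternExpr _ (narrowQP_twoRow_pinnedAffine H hsymm hH)

/-- **Second-row-quadratic 2-row families have square-symmetric circuits of quasi-polynomial SIZE.**
[cite: BlaserJindal2019, Thm. 4] -/
theorem qpSymmetricSize_twoRow_pinnedQuadratic (H : (n : ℕ) → MvPolynomial (Option (Option (Fin n))) ℂ)
    (hsymm : ∀ (n : ℕ) (τ : Equiv.Perm (Fin n)), rename (Option.map (Option.map τ)) (H n) = H n)
    (hH : IsVQPFamily H) :
    ∃ c : ℕ, ∀ n : ℕ, ∃ (G : Type) (_ : Fintype G)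
      (C : LabelledArithCircuit ℂ (Fin n × Fin n) Unit G),
      C.IsSymmetric (Equiv.Perm (Fin n)) ∧
        C.eval (C.output ()) = ∑ i : Fin n, ∑ b : Fin n, ∑ b' : Fin n,
          (∑ i' : Fin n, (X (i', b) : MvPolynomial (Fin n × Fin n) ℂ) * X (i', b')) *
          aeval (fun o : Option (Option (Fin n)) => o.elim (X (i, b))
            (fun o' => o'.elim (X (i, b'))
              (fun j => (X (i, j) : MvPolynomial (Fin n × Fin n) ℂ)))) (H n) ∧
        Fintype.card G ≤ 2 ^ ((Nat.log 2 n + c) ^ c) :=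
  qpSymmetric_patternExpr _ (narrowQP_twoRow_pinnedQuadratic H hsymm hH)

/-- **Pinned-product 2-row families have square-symmetric circuits of quasi-polynomial SIZE.**
[cite: BlaserJindal2019, Thm. 4] -/
theorem qpSymmetricSize_twoRow_pinnedProduct (U H : (n : ℕ) → MvPolynomial (Option (Fin n)) ℂ)
    (hUs : ∀ (n : ℕ) (τ : Equiv.Perm (Fin n)), rename (Option.map τ) (U n) = U n)
    (hHs : ∀ (n : ℕ) (τ : Equiv.Perm (Fin n)), rename (Option.map τ) (H n) = H n)
    (hU : IsVQPFamily U) (hH : IsVQPFamily H) :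
    ∃ c : ℕ, ∀ n : ℕ, ∃ (G : Type) (_ : Fintype G)
      (C : LabelledArithCircuit ℂ (Fin n × Fin n) Unit G),
      C.IsSymmetric (Equiv.Perm (Fin n)) ∧
        C.eval (C.output ()) = ∑ b : Fin n,
          (∑ i' : Fin n, aeval (fun o : Option (Fin n) => o.elim (X (i', b))
            (fun j => (X (i', j) : MvPolynomial (Fin n × Fin n) ℂ))) (U n)) *
          (∑ i : Fin n, aeval (fun o : Option (Fin n) => o.elim (X (i, b))
            (fun j => (X (i, j) : MvPolynomial (Fin n × Fin n) ℂ))) (H n)) ∧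
        Fintype.card G ≤ 2 ^ ((Nat.log 2 n + c) ^ c) :=
  qpSymmetric_patternExpr _ (narrowQP_twoRow_pinnedProduct U H hUs hHs hU hH)

/-- **Two-pinned-product 2-row families have square-symmetric circuits of quasi-polynomial SIZE.**
[cite: BlaserJindal2019, Thm. 4] -/
theorem qpSymmetricSize_twoRow_twoPinnedProduct (U H : (n : ℕ) → MvPolynomial (Option (Option (Fin n))) ℂ)
    (hUs : ∀ (n : ℕ) (τ : Equiv.Perm (Fin n)), rename (Option.map (Option.map τ)) (U n) = U n)
    (hHs : ∀ (n : ℕ) (τ : Equiv.Perm (Fin n)), rename (Option.map (Option.map τ)) (H n) = H n)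
    (hU : IsVQPFamily U) (hH : IsVQPFamily H) :
    ∃ c : ℕ, ∀ n : ℕ, ∃ (G : Type) (_ : Fintype G)
      (C : LabelledArithCircuit ℂ (Fin n × Fin n) Unit G),
      C.IsSymmetric (Equiv.Perm (Fin n)) ∧
        C.eval (C.output ()) = ∑ b : Fin n, ∑ b' : Fin n,
          (∑ i' : Fin n, aeval (fun o : Option (Option (Fin n)) => o.elim (X (i', b))
            (fun o' => o'.elim (X (i', b'))
              (fun j => (X (i', j) : MvPolynomial (Fin n × Fin n) ℂ)))) (U n)) *
          (∑ i : Fin n, aeval (fun o : Option (Option (Fin n)) => o.elim (X (i, b))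
            (fun o' => o'.elim (X (i, b'))
              (fun j => (X (i, j) : MvPolynomial (Fin n × Fin n) ℂ)))) (H n)) ∧
        Fintype.card G ≤ 2 ^ ((Nat.log 2 n + c) ^ c) :=
  qpSymmetric_patternExpr _ (narrowQP_twoRow_twoPinnedProduct U H hUs hHs hU hH)

end FormulaSubstitution

end Summit.ValiantsHypothesis.ValiantsHypothesis.Theorems

end
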